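import Summits.CriticalPhenomena.PercolationContinuityZ3.Theorems.Transplant.FKConnectivityAllQAntipodalX2WordsSigma
import HarnessLib

/-!
# Connectivity correlation inequalities for `φ_{w,q}` — σ-WORDS, file 12: blocks and the type word

Helper file (`--supports stmt-CriticalPhenomena-4575`), FK sub-lane `prim-bschramm-fk-2` (gen 13); builds on p205010 (kernel
theorem, internal audit signed; external expert review pending).  Pure finite combinatorics (memo `bschramm/FROM-fk-2-g13-WORD-HALL.md`
§1.3 and §7.2: the LIFT of Theorem A from type words to gen 12's σ-words).
`blocks` groups a word into maximal runs of letters of one kind; `typeword`/`kind0` give the type word of the type model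
(`E` = all letters `01`, `F` = all `10`, `M` otherwise); `flatten_blocks`, `blocks_letters`, `blocks_kinds_eq`/`blocks_kind`
(the kinds of the blocks alternate from `kind0`).
[cite: Grimmett2006, §3.9 (p. 63)]
-/

namespace Summit.CriticalPhenomena.PercolationContinuityZ3.Theorems

namespace FK

namespace X2Word

/-! ### Blocks of an inert-free σ-word and its type word -/

section Blocks

/-- Group a word into maximal runs of letters of equal kind ("blocks"). [folklore] -/
def blocks : List SLetter → List (Kind × List SLetter)
  | [] => []
  | l :: w =>
    match blocks w with
    | [] => [(l.1, [l])]
    | (k, ls) :: rest => if l.1 = k then (k, l :: ls) :: rest else (l.1, [l]) :: (k, ls) :: rest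

/-- Type of a block: `E` if all its letters are `01` (λ), `F` if all are `10` (ω), `M` otherwise (mixed or frozen). [folklore] -/
def tyOf (ls : List SLetter) : Ty :=
  if ls.all (fun l => l.2 = (false, true)) then .E else if ls.all (fun l => l.2 = (true, false)) then .F else .M

/-- The TYPE WORD of a σ-word (computed on its blocks). [folklore] -/
def typeword (w : List SLetter) : List Ty := (blocks w).map fun b => tyOf b.2

/-- The kind of the first block (default `W` for the empty word). [folklore] -/
def kind0 (w : List SLetter) : Kind := ((blocks w).head?.map (·.1)).getD .W

/-- Flattening the blocks gives the word back. [folklore] -/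
theorem flatten_blocks (w : List SLetter) : ((blocks w).flatMap fun b => b.2) = w := by
  induction w with
  | nil => rfl
  | cons l w ih =>
    simp only [blocks]
    rcases hb : blocks w with _ | ⟨⟨k, ls⟩, rest⟩
    · rw [hb] at ih; simp at ih; subst ih; rfl
    · rw [hb] at ih
      simp only
      split_ifs with hk
      · simp only [List.flatMap_cons, List.cons_append] at ih ⊢; rw [ih]
      · simp only [List.flatMap_cons, List.cons_append, List.nil_append] at ih ⊢; rw [ih]

/-- Every block is nonempty and all its letters have the block's kind. [folklore] -/
theorem blocks_letters (w : List SLetter) : ∀ b ∈ blocks w, b.2 ≠ [] ∧ ∀ l ∈ b.2, l.1 = b.1 := by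
  induction w with
  | nil => simp [blocks]
  | cons l w ih =>
    simp only [blocks]
    rcases hb : blocks w with _ | ⟨⟨k, ls⟩, rest⟩
    · intro b hbm; simp at hbm; subst hbm; simp
    · rw [hb] at ih
      simp only
      split_ifs with hk
      · intro b hbm
        rcases List.mem_cons.mp hbm with rfl | hbm
        · refine ⟨by simp, ?_⟩
          intro l' hl'
          rcases List.mem_cons.mp hl' with rfl | hl'
          · exact hk
          · exact (ih (k, ls) (by simp)).2 l' hl'
        · exact ih b (List.mem_cons_of_mem _ hbm)
      · intro b hbm
        rcases List.mem_cons.mp hbm with rfl | hbm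
        · simp
        · exact ih b hbm

/-- The first block starts with the first letter's kind. [folklore] -/
theorem blocks_head_kind (l : SLetter) (w : List SLetter) : ∃ b rest, blocks (l :: w) = b :: rest ∧ b.1 = l.1 := by
  simp only [blocks]
  rcases hb : blocks w with _ | ⟨⟨k, ls⟩, rest⟩
  · exact ⟨_, _, rfl, rfl⟩
  · simp only
    split_ifs with hk
    · exact ⟨_, _, rfl, hk.symm⟩
    · exact ⟨_, _, rfl, rfl⟩

/-- `kind0` of a nonempty word is the kind of its first letter. [folklore] -/
theorem kind0_cons (l : SLetter) (w : List SLetter) : kind0 (l :: w) = l.1 := by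
  obtain ⟨b, rest, hb, hk⟩ := blocks_head_kind l w
  unfold kind0; rw [hb]; simpa using hk

/-- The kinds of the blocks are `kind0, kind0.other, kind0, …` (alternation). [folklore] -/
theorem blocks_kinds_eq (w : List SLetter) :
    (blocks w).map (·.1) = (List.range (blocks w).length).map (kindAt (kind0 w)) := by
  induction w with
  | nil => rfl
  | cons l w ih =>
    rw [kind0_cons]
    simp only [blocks]
    rcases hb : blocks w with _ | ⟨⟨k, ls⟩, rest⟩
    · simp [kindAt]
    · rw [hb] at ih
      have hk0 : kind0 w = k := by unfold kind0; rw [hb]; rfl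
      rw [hk0] at ih
      simp only
      split_ifs with hk
      · -- same block: the kind list is that of `blocks w`
        rw [hk]; simpa using ih
      · -- a new block of kind l.1 in front; the old list starts with k = l.1.other
        have hk' : k = l.1.other := by
          revert hk; cases k <;> cases l.1 <;> simp
        rw [List.map_cons, ih]
        conv_rhs => rw [List.length_cons, List.range_succ_eq_map, List.map_cons, List.map_map]
        congr 1
        apply List.map_congr_left
        intro j _
        simp only [Function.comp, hk', kindAt, Function.iterate_succ_apply]

/-- Block `j` has kind `kindAt (kind0 w) j`. [folklore] -/
theorem blocks_kind (w : List SLetter) (j : ℕ) (hj : j < (blocks w).length) : ((blocks w)[j]).1 = kindAt (kind0 w) j := by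
  have h := congrArg (fun L => L[j]?) (blocks_kinds_eq w)
  simp only [List.getElem?_map, List.getElem?_range hj] at h
  rw [List.getElem?_eq_getElem hj] at h
  simpa using h

end Blocks


end X2Word

end FK

end Summit.CriticalPhenomena.PercolationContinuityZ3.Theorems
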